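import Summits.QuantumFields.BalabanUV.Beta.D1BFx.ChartDefectLiteralColumnPin
import Summits.QuantumFields.BalabanUV.Beta.D1BFx.ChartDefectLiteralChartPin

/-!
# `BalabanUV.Beta.D1BFx.ChartDefectTwoPinsLiteral` — road «BF-x», binder row D1, PART 24 HEAD (H3-literal) at the RECORD (`PART24-HEAD-SPEC-g24.md` v1.1 §3;
# an2 R-D1-g45-5 «two-pin reading; identities at both pins FIRST»): **THE LITERAL OF RECORD's ONE-LOOP WORD AT ITS OWN PIN IS THE STRAIGHT WORD DISPLACED
# BY NAMED WORDS ONLY** — at the literal's propagator `G′ = GcombSh n 0` (`RelInv G′ (bhK + Dsh) axEc`) BOTH gauge layers of the literal's vertices cancel: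
# the CHART layer (`G′ = Ψ̂∘G₀∘Ψ̂ᵀ`, face gauge generator `Λf[G₀]`: leaf-03 g31's TT10 `SymCorrectorFaceGauge` + TT20 `SymCorrectorW2SiteGauge` with the record's
# letters `CombPairSlotLetters` ∕ `CombMixedSiteLetter` + TT18 `SymCorrectorResponseNull` for the response rest) — `ChartDefectLiteralChartPin.hessKer_GcombSh_chartPin_record` —
# and the COLUMN layer (`G₀ = coDressKBmAt ρ_c n K₀`, generator `Λc[K₀]`: `ChartDefectLiteralColumnPin`), composed in `hessKer_literal_record_eq`:
# `hessKer G′ (vertexOfK G′ n S⁰) (W2SymOfK G′ n S♭ M⁰ S₂⁰ M₂⁰) = hessKer G′ (vertexOfK K₀ n S⁰) (W2SymOfK K₀ n S♭ M⁰ S₂⁰ M₂⁰ + W^{Λ}_c + W^{Mcol}_c + (WMs + W^{Λ}_f))`.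
# The displaced words are NAMED here (written out), not bounded: `W^{Λ}_c`, `W^{Mcol}_c` (column layer), `WMs` (leaf-03's site-law mixed word at `G₀`, scalar `2`
# against `H = symHessFFAt ρ_c n`), `W^{Λ}_f := Wmix(Λf; vertexOfK G₀ n S♭) − Wmix(Λf; vertexOfK G₀ n S⁰)` (the chart layer's Λ-sector word).

HONEST DEPENDENCY (cell records, verbatim): «continuum YM on T⁴ ⇐ BetaPertH ∧ nine spine estimates (0/9 proved); BetaPertH ⇐ (D1) ∧ (D4) ∧
CAP+tail; G-an2-4 gates asym, D1 and NE2/3/4.»  HONEST FRAMING (cell contract, verbatim): «discharging `BetaPertH` makes Bałaban's UV stability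
UNCONDITIONAL — a real constructive-QFT result; it is NOT the continuum limit and NOT the Clay problem.»  THIS MODULE DISCHARGES NO binder of row D1 and
NO estimate of Bałaban's: [our object] identities between OUR kernels composed BY NAME; the colour data `Complete τ`, `TrOrthonormal τ`, `N ≠ 0` are
HYPOTHESES (displayed); prices NO row; no definition, no `def … : Prop`, nothing cited, 0 sorry.  0∕4 row-D1 binders; (K) NOT closed; (J1) ONE OPEN ROW;
NOT D1, NEVER «G-an2-4 closed», NOT `BetaPertH`, NOT continuum, NOT Clay.

ABSOLUTE RULE (cell charter, verbatim): «No internally-minted statement may enter as a cited fact. Every hypothesis is either kernel-proved in this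
package or a verbatim quotation of a PUBLISHED theorem with page reference. The manuscript(s) under audit are NOT citable for their own disputed
steps — they are the thing under adjudication; programme-internal (2001/route/tribunal) claims are never citable.»

Unit `b2b-balaban-beta-d1-p2` (road owner, gen 24), 2026-08-23; no existing file touched.
-/

noncomputable section

namespace Summit.QuantumFields.BalabanUV.Beta.D1BFx.ChartDefectTwoPinsLiteral

open Finset
open scoped BigOperators
open Literature.MathematicalPhysics.QuantumFieldTheory
open Literature.MathematicalPhysics.QuantumFieldTheory.Balaban1983to89
open Literature.MathematicalPhysics.QuantumFieldTheory.Balaban1983to89.Beta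
open ColourTrace (Complete TrOrthonormal)
open WilsonVertex2Sym (wsym22)
open WilsonBiStencil (wilsonW₂)
open StepJetData (wilsonA)
open ExpKernelCalculus (comp hessKer)
open OneStepKernelFamily (colH vertexOfK KInvStep)
open SecondOrderResponse (vertexOfM mixOfK W2SymOfK)
open BalabanStepW2 (M2Of)
open AffineAveraging (Site)
open AveragingContours (blk)
open AveragingContoursRooted (ctr ctrOff)
open Summit.QuantumFields.BalabanUV.Beta.BorderedHessian (diagK)
open Summit.QuantumFields.BalabanUV.Beta.AxialDressingRooted (coDressKBmAt)
open Summit.QuantumFields.BalabanUV.Beta.AxialProjectorBlockMean (bmGaugeAt)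
open Summit.QuantumFields.BalabanUV.Beta.AveragingWardRootedStencils (legSite)
open Summit.QuantumFields.BalabanUV.Beta.SymAveragingHessianCounts (symVhSAt symHessFFAt)
open Summit.QuantumFields.BalabanUV.Beta.SymSecondOrderTablesAn1 (symVh₂SAn1 symTablesAn1S2)
open Summit.QuantumFields.BalabanUV.Beta.CombChartStepJets (GcombSh JsB12CombSh0)
open Summit.QuantumFields.BalabanUV.Beta.CompositeCorrectorLocality (blockSitesF)
open Summit.QuantumFields.BalabanUV.Beta.SymCorrectorFace (faceWt)
open Summit.QuantumFields.BalabanUV.Beta.D1BFx.ChartDefectLiteralColumnPin (hessKer_GcombSh_columnPin_record)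
open Summit.QuantumFields.BalabanUV.Beta.D1BFx.ChartDefectLiteralChartPin (loc_chartWords_record hessKer_GcombSh_chartPin_record)

variable {n : ℕ} [NeZero n] {N : ℕ} {C : Type*} [Fintype C] [DecidableEq C] {τ : C → Matrix (Fin N) (Fin N) ℂ}

/-- **THE LITERAL OF RECORD AT ITS OWN PIN, BOTH LAYERS** [our object] ((H3-literal) at the record): the literal's one-loop word
`hessKer G′ (vertexOfK G′ n S⁰) (W2SymOfK G′ n S♭ M⁰ S₂⁰ M₂⁰)` (TT8 `JsB12CombSh0_W_zero_eq`: this W IS `(JsB12CombSh0 … 0).W`) equals the STRAIGHT objects at `K₀` plus the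
displaced words ONLY: `hessKer G′ (vertexOfK K₀ n S⁰) (μ y ν y′ ↦ W2SymOfK K₀ n S♭ M⁰ S₂⁰ M₂⁰ μ y ν y′ + W^{Λ}_c + W^{Mcol}_c + (WMs + W^{Λ}_f)) μ₀ ν₀ z₀` —
`ChartDefectLiteralChartPin.hessKer_GcombSh_chartPin_record`, then `ChartDefectLiteralColumnPin.hessKer_GcombSh_columnPin_record` with `X := WMs + W^{Λ}_f`. -/
theorem hessKer_literal_record_eq (hodd : Odd n) (hτ : Complete τ) (ho : TrOrthonormal τ) (hN : N ≠ 0) (c : C) (cΛ : ℝ)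
    (μ₀ ν₀ : Fin 4) (z₀ : Site 4) :
    hessKer (GcombSh (d := 3) n 0) (vertexOfK (GcombSh (d := 3) n 0) n (JsB12CombSh0 hodd N (symTablesAn1S2 3 n cΛ) cΛ (-((n : ℝ) ^ 12 / 4)) 0).S)
        (W2SymOfK (GcombSh (d := 3) n 0) n (fun κ u => ((n : ℝ) ^ 4) • wilsonA 3 κ u + (-((n : ℝ) ^ 8 / 2)) • symVhSAt (ctr 4 n) 3 n rfl κ u)
          ((symTablesAn1S2 3 n cΛ).M 0) (fun κ u κ' u' => ((n : ℝ) ^ 8) • wilsonW₂ 3 ((8 * (N : ℝ) ^ 2)⁻¹ • wsym22 N) κ u κ' u' + (-((n : ℝ) ^ 12 / 4)) • symVh₂SAn1 3 n κ u κ' u')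
          (M2Of 3 n (symTablesAn1S2 3 n cΛ).mixFF 0)) μ₀ ν₀ z₀
      = hessKer (GcombSh (d := 3) n 0) (vertexOfK (KInvStep (d := 3) n 0) n (JsB12CombSh0 hodd N (symTablesAn1S2 3 n cΛ) cΛ (-((n : ℝ) ^ 12 / 4)) 0).S)
        (fun μ y ν y' =>
          W2SymOfK (KInvStep (d := 3) n 0) n (fun κ u => ((n : ℝ) ^ 4) • wilsonA 3 κ u + (-((n : ℝ) ^ 8 / 2)) • symVhSAt (ctr 4 n) 3 n rfl κ u)
              ((symTablesAn1S2 3 n cΛ).M 0) (fun κ u κ' u' => ((n : ℝ) ^ 8) • wilsonW₂ 3 ((8 * (N : ℝ) ^ 2)⁻¹ • wsym22 N) κ u κ' u' + (-((n : ℝ) ^ 12 / 4)) • symVh₂SAn1 3 n κ u κ' u')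
              (M2Of 3 n (symTablesAn1S2 3 n cΛ).mixFF 0) μ y ν y'
          + ((((comp (diagK fun z' b => (n : ℝ) ^ 4 / 2 * bmGaugeAt (ctr 4 n) (colH (KInvStep (d := 3) n 0) n ν y') n (legSite (ctr 4 n) z' b)) (vertexOfK (KInvStep (d := 3) n 0) n (fun κ u => ((n : ℝ) ^ 4) • wilsonA 3 κ u + (-((n : ℝ) ^ 8 / 2)) • symVhSAt (ctr 4 n) 3 n rfl κ u) μ y)
                - comp (vertexOfK (KInvStep (d := 3) n 0) n (fun κ u => ((n : ℝ) ^ 4) • wilsonA 3 κ u + (-((n : ℝ) ^ 8 / 2)) • symVhSAt (ctr 4 n) 3 n rfl κ u) μ y) (diagK fun z' b => (n : ℝ) ^ 4 / 2 * bmGaugeAt (ctr 4 n) (colH (KInvStep (d := 3) n 0) n ν y') n (legSite (ctr 4 n) z' b)))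
              + (comp (diagK fun z' b => (n : ℝ) ^ 4 / 2 * bmGaugeAt (ctr 4 n) (colH (KInvStep (d := 3) n 0) n μ y) n (legSite (ctr 4 n) z' b)) (vertexOfK (KInvStep (d := 3) n 0) n (fun κ u => ((n : ℝ) ^ 4) • wilsonA 3 κ u + (-((n : ℝ) ^ 8 / 2)) • symVhSAt (ctr 4 n) 3 n rfl κ u) ν y')
                - comp (vertexOfK (KInvStep (d := 3) n 0) n (fun κ u => ((n : ℝ) ^ 4) • wilsonA 3 κ u + (-((n : ℝ) ^ 8 / 2)) • symVhSAt (ctr 4 n) 3 n rfl κ u) ν y') (diagK fun z' b => (n : ℝ) ^ 4 / 2 * bmGaugeAt (ctr 4 n) (colH (KInvStep (d := 3) n 0) n μ y) n (legSite (ctr 4 n) z' b)))))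
            - (((comp (diagK fun z' b => (n : ℝ) ^ 4 / 2 * bmGaugeAt (ctr 4 n) (colH (KInvStep (d := 3) n 0) n ν y') n (legSite (ctr 4 n) z' b)) (vertexOfK (KInvStep (d := 3) n 0) n (JsB12CombSh0 hodd N (symTablesAn1S2 3 n cΛ) cΛ (-((n : ℝ) ^ 12 / 4)) 0).S μ y)
                - comp (vertexOfK (KInvStep (d := 3) n 0) n (JsB12CombSh0 hodd N (symTablesAn1S2 3 n cΛ) cΛ (-((n : ℝ) ^ 12 / 4)) 0).S μ y) (diagK fun z' b => (n : ℝ) ^ 4 / 2 * bmGaugeAt (ctr 4 n) (colH (KInvStep (d := 3) n 0) n ν y') n (legSite (ctr 4 n) z' b)))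
              + (comp (diagK fun z' b => (n : ℝ) ^ 4 / 2 * bmGaugeAt (ctr 4 n) (colH (KInvStep (d := 3) n 0) n μ y) n (legSite (ctr 4 n) z' b)) (vertexOfK (KInvStep (d := 3) n 0) n (JsB12CombSh0 hodd N (symTablesAn1S2 3 n cΛ) cΛ (-((n : ℝ) ^ 12 / 4)) 0).S ν y')
                - comp (vertexOfK (KInvStep (d := 3) n 0) n (JsB12CombSh0 hodd N (symTablesAn1S2 3 n cΛ) cΛ (-((n : ℝ) ^ 12 / 4)) 0).S ν y') (diagK fun z' b => (n : ℝ) ^ 4 / 2 * bmGaugeAt (ctr 4 n) (colH (KInvStep (d := 3) n 0) n μ y) n (legSite (ctr 4 n) z' b))))))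
          + ((mixOfK (coDressKBmAt (ctr 4 n) n (KInvStep (d := 3) n 0)) n (M2Of 3 n (symTablesAn1S2 3 n cΛ).mixFF 0) μ y ν y'
                - mixOfK (KInvStep (d := 3) n 0) n (M2Of 3 n (symTablesAn1S2 3 n cΛ).mixFF 0) μ y ν y')
            + (mixOfK (coDressKBmAt (ctr 4 n) n (KInvStep (d := 3) n 0)) n (M2Of 3 n (symTablesAn1S2 3 n cΛ).mixFF 0) ν y' μ y
                - mixOfK (KInvStep (d := 3) n 0) n (M2Of 3 n (symTablesAn1S2 3 n cΛ).mixFF 0) ν y' μ y))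
          + (((mixOfK (coDressKBmAt (ctr 4 n) n (KInvStep (d := 3) n 0)) n (fun κ u ρ w => (if blk n ((n : ℤ) • w + (ctr 4 n)) = blk n u then 2 * faceWt (ctrOff 4 n) n κ u else 0) • (symHessFFAt (ctr 4 n) n) ρ w) μ y ν y'
                + mixOfK (coDressKBmAt (ctr 4 n) n (KInvStep (d := 3) n 0)) n (fun κ u ρ w => (if blk n ((n : ℤ) • w + (ctr 4 n)) = blk n u then 2 * faceWt (ctrOff 4 n) n κ u else 0) • (symHessFFAt (ctr 4 n) n) ρ w) ν y' μ y)
              - (comp (diagK fun z b => ∑ α : Fin (3 + 1), ∑ x ∈ blockSitesF n (blk n (legSite (ctr 4 n) z b)), colH (coDressKBmAt (ctr 4 n) n (KInvStep (d := 3) n 0)) n μ y α x * (2 * faceWt (ctrOff 4 n) n α x)) (vertexOfM (coDressKBmAt (ctr 4 n) n (KInvStep (d := 3) n 0)) n (symHessFFAt (ctr 4 n) n) ν y')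
                + comp (diagK fun z b => ∑ α : Fin (3 + 1), ∑ x ∈ blockSitesF n (blk n (legSite (ctr 4 n) z b)), colH (coDressKBmAt (ctr 4 n) n (KInvStep (d := 3) n 0)) n ν y' α x * (2 * faceWt (ctrOff 4 n) n α x)) (vertexOfM (coDressKBmAt (ctr 4 n) n (KInvStep (d := 3) n 0)) n (symHessFFAt (ctr 4 n) n) μ y)))
          + ((((comp (diagK fun z b => -(∑ α : Fin (3 + 1), ∑ x ∈ blockSitesF n (blk n (legSite (ctr 4 n) z b)), colH (coDressKBmAt (ctr 4 n) n (KInvStep (d := 3) n 0)) n ν y' α x * (((n : ℝ) ^ 4 / 2) * faceWt (ctrOff 4 n) n α x))) (vertexOfK (coDressKBmAt (ctr 4 n) n (KInvStep (d := 3) n 0)) n (fun κ u => ((n : ℝ) ^ 4) • wilsonA 3 κ u + (-((n : ℝ) ^ 8 / 2)) • symVhSAt (ctr 4 n) 3 n rfl κ u) μ y)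
                - comp (vertexOfK (coDressKBmAt (ctr 4 n) n (KInvStep (d := 3) n 0)) n (fun κ u => ((n : ℝ) ^ 4) • wilsonA 3 κ u + (-((n : ℝ) ^ 8 / 2)) • symVhSAt (ctr 4 n) 3 n rfl κ u) μ y) (diagK fun z b => -(∑ α : Fin (3 + 1), ∑ x ∈ blockSitesF n (blk n (legSite (ctr 4 n) z b)), colH (coDressKBmAt (ctr 4 n) n (KInvStep (d := 3) n 0)) n ν y' α x * (((n : ℝ) ^ 4 / 2) * faceWt (ctrOff 4 n) n α x))))
              + (comp (diagK fun z b => -(∑ α : Fin (3 + 1), ∑ x ∈ blockSitesF n (blk n (legSite (ctr 4 n) z b)), colH (coDressKBmAt (ctr 4 n) n (KInvStep (d := 3) n 0)) n μ y α x * (((n : ℝ) ^ 4 / 2) * faceWt (ctrOff 4 n) n α x))) (vertexOfK (coDressKBmAt (ctr 4 n) n (KInvStep (d := 3) n 0)) n (fun κ u => ((n : ℝ) ^ 4) • wilsonA 3 κ u + (-((n : ℝ) ^ 8 / 2)) • symVhSAt (ctr 4 n) 3 n rfl κ u) ν y')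
                - comp (vertexOfK (coDressKBmAt (ctr 4 n) n (KInvStep (d := 3) n 0)) n (fun κ u => ((n : ℝ) ^ 4) • wilsonA 3 κ u + (-((n : ℝ) ^ 8 / 2)) • symVhSAt (ctr 4 n) 3 n rfl κ u) ν y') (diagK fun z b => -(∑ α : Fin (3 + 1), ∑ x ∈ blockSitesF n (blk n (legSite (ctr 4 n) z b)), colH (coDressKBmAt (ctr 4 n) n (KInvStep (d := 3) n 0)) n μ y α x * (((n : ℝ) ^ 4 / 2) * faceWt (ctrOff 4 n) n α x))))))
            - (((comp (diagK fun z b => -(∑ α : Fin (3 + 1), ∑ x ∈ blockSitesF n (blk n (legSite (ctr 4 n) z b)), colH (coDressKBmAt (ctr 4 n) n (KInvStep (d := 3) n 0)) n ν y' α x * (((n : ℝ) ^ 4 / 2) * faceWt (ctrOff 4 n) n α x))) (vertexOfK (coDressKBmAt (ctr 4 n) n (KInvStep (d := 3) n 0)) n (JsB12CombSh0 hodd N (symTablesAn1S2 3 n cΛ) cΛ (-((n : ℝ) ^ 12 / 4)) 0).S μ y)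
                - comp (vertexOfK (coDressKBmAt (ctr 4 n) n (KInvStep (d := 3) n 0)) n (JsB12CombSh0 hodd N (symTablesAn1S2 3 n cΛ) cΛ (-((n : ℝ) ^ 12 / 4)) 0).S μ y) (diagK fun z b => -(∑ α : Fin (3 + 1), ∑ x ∈ blockSitesF n (blk n (legSite (ctr 4 n) z b)), colH (coDressKBmAt (ctr 4 n) n (KInvStep (d := 3) n 0)) n ν y' α x * (((n : ℝ) ^ 4 / 2) * faceWt (ctrOff 4 n) n α x))))
              + (comp (diagK fun z b => -(∑ α : Fin (3 + 1), ∑ x ∈ blockSitesF n (blk n (legSite (ctr 4 n) z b)), colH (coDressKBmAt (ctr 4 n) n (KInvStep (d := 3) n 0)) n μ y α x * (((n : ℝ) ^ 4 / 2) * faceWt (ctrOff 4 n) n α x))) (vertexOfK (coDressKBmAt (ctr 4 n) n (KInvStep (d := 3) n 0)) n (JsB12CombSh0 hodd N (symTablesAn1S2 3 n cΛ) cΛ (-((n : ℝ) ^ 12 / 4)) 0).S ν y')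
                - comp (vertexOfK (coDressKBmAt (ctr 4 n) n (KInvStep (d := 3) n 0)) n (JsB12CombSh0 hodd N (symTablesAn1S2 3 n cΛ) cΛ (-((n : ℝ) ^ 12 / 4)) 0).S ν y') (diagK fun z b => -(∑ α : Fin (3 + 1), ∑ x ∈ blockSitesF n (blk n (legSite (ctr 4 n) z b)), colH (coDressKBmAt (ctr 4 n) n (KInvStep (d := 3) n 0)) n μ y α x * (((n : ℝ) ^ 4 / 2) * faceWt (ctrOff 4 n) n α x))))))))) μ₀ ν₀ z₀ := by
  rw [hessKer_GcombSh_chartPin_record hodd hτ ho hN c cΛ μ₀ ν₀ z₀]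
  exact hessKer_GcombSh_columnPin_record hodd hτ ho hN c cΛ _ (loc_chartWords_record (N := N) hodd cΛ) μ₀ ν₀ z₀

end Summit.QuantumFields.BalabanUV.Beta.D1BFx.ChartDefectTwoPinsLiteral

end
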